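/-
Copyright (c) 2026. All rights reserved.
Released under Apache 2.0 license as described in the file LICENSE.
Authors: abc-iut cell — seat abc-iut-w4-d071 (wave 4, gen 4; §4(iii) non-vacuity programme, layer L4:
the zero row `AbsTopII.EllipticAdmissibilityWitness` of INHABITATION-CENSUS-L4-v5).
-/
import Literature.AnabelianGeometry.AbsoluteAnabelian.AbsTopII.EllipticAdmissible
import Literature.AnabelianGeometry.AbsoluteAnabelian.FreeProcyclicModel
import Mathlib.NumberTheory.Padics.ProperSpace
import Mathlib.Topology.MetricSpace.Ultra.TotallySeparated
import HarnessLib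

/-!
# [AbsTopII] Def 3.1 (elliptically admissible) and Cor 3.3 (ii) as typed are JOINTLY SATISFIABLE:
# the 2-adic isogeny-level model (non-vacuity record; proof-only)

S. Mochizuki, *Topics in Absolute Anabelian Geometry II: Decomposition Groups and Endomorphisms*
[AbsTopII] (bib `MochizukiAbsTopII2013`; locators = PDF pages of the manuscript
`paper:url-585b8d0ad0d9`), §3: Definition 3.1 p. 65 ("`Π`-elliptically admissible": (a) a
`k`-core `X → C`, (b) `C` semi-elliptic with double covering `D → C` by a once-punctured elliptic
curve, (c) a covering `Y → X` arising from a normal open `Π_Y ⊆ Π` with `Y → C` factoring through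
`D → C`, the pro-`Σ` clause on `Δ` and the `Σ`-integrality of `deg(Y → C ×_k k_Y)`), and
Corollary 3.3 (ii) p. 68 (the double coverings exhibiting a semi-elliptic `C` "may be characterized
group-theoretically as the open subgroups `J ⊆ Π_C` of index `2` such that `J ∩ Δ_C` is
torsion-free").

abc-iut-L4-t6 typed these over the isogeny-level MODEL INTERFACE `IsogenyModel` (shape (M);
`AbsTopII/EllipticAdmissible.lean`, p404980, DEFINITION FROZEN): the data record
`EllipticAdmissibilityWitness M X Q`, the predicates `IsEllipticallyAdmissible(With)`, and the
schema `Cor_3_3_ii M`.  `AbsTopII/EllipticAdmissibleClosures.lean` REFUTES the universal closure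
`∀ M, Cor_3_3_ii M` at a finite model (`Π_C = ℤ/2 × ℤ/2`), and abc-iut-w5-d197's kernel census
INHABITATION-CENSUS-L4-v5 lists `EllipticAdmissibilityWitness` with ZERO inhabitants.  A finite model
CANNOT inhabit it: the pro-`Σ` clause of Def 3.1 (c) quantifies over every `Σ` for which SOME open
subgroup of `Δ` is pro-`Σ`; at a finite `Δ` the trivial open subgroup is pro-`∅`, so the clause
would force `deg = 1`, contradicting the degree-`2` factorisation through `D → C`.

This PROOF-ONLY file (no `def` / `instance` / `structure`; the model is built inside the proofs)
supplies the complementary SATISFIABILITY half at an INFINITE model — the **2-adic isogeny-level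
model**: two "curves" `C` (a properly stacky core) and `D` (a once-punctured elliptic curve, a
scheme); every extension is `ℤ₂ ↠ 1` (Mathlib's `ℤ_[2]`, written multiplicatively; trivial Galois
group, so `Δ = Π = ℤ₂`); the `k`-morphisms are `D → D`, `C → C` (identities) and the double covering
`D → C`, realised on `Π` by `x ↦ 2x` (open injective with image `2ℤ₂` of index `2`).

* `exists_isEllipticallyAdmissible_model` — `D` is elliptically admissible as typed (`X := D`,
  `Π := π₁(X)`, core `C`, `Y := D`, `Π_Y := Π`), it is a once-punctured elliptic curve as typed, and
  `Δ_X` is INFINITE: the pro-`Σ` clause holds NON-vacuously — `Δ = ℤ₂` is free pro-`{2}`-cyclic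
  (`isFreeProSigmaCyclic_singleton_padicInt`), "some open subgroup of `Δ` is pro-`Σ`" forces `2 ∈ Σ`,
  whence `Δ` is pro-`Σ` and `deg(Y → C ×_k k_Y) = 2` is a `Σ`-integer;
* `nonempty_ellipticAdmissibilityWitness` — the census form;
* `exists_cor_3_3_ii_model` — at the SAME model the typed schema `Cor_3_3_ii M` HOLDS with its
  hypothesis met (`C` is semi-elliptic as typed): `ℤ₂` is torsion-free and `2ℤ₂` is its unique
  subgroup of index `2`.  So FACT-LIST row F-0234 is a CONTINGENT schema — refuted universally
  (`not_forall_cor_3_3_ii`), satisfied here — i.e. a genuine hypothesis on the model, consumable by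
  name, exactly as its docstring says.

HONEST LABEL: a TOY at the 2-adic skeleton (no curve, no field, trivial Galois group; "genus",
"cusps", "scheme" are the interface's predicate-valued data); it certifies the JOINT CONSISTENCY of
OUR typing of Def 3.1 (a)(b)(c) and of Cor 3.3 (ii), nothing about hyperbolic orbicurves or about
the published theorems.  Witnessed ≠ endorsed; typed ≠ proved; no side taken on [IUTchIII] Cor 3.12.
-/

noncomputable section

open CategoryTheory Topology

namespace Literature.AnabelianGeometry.AbsoluteAnabelian.AbsTopII

open FundamentalExtension
open Literature.AnabelianGeometry.Anabelioids (IsSigmaInteger)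

/-- **The 2-adic isogeny-level model of [AbsTopII] Def 3.1 and Cor 3.3 (ii) as typed.**  There is an
`IsogenyModel` with a curve `X` such that: `X` is a once-punctured elliptic curve as typed; `X` is
elliptically admissible as typed (Def 3.1 with `Π = π₁(X)`: core `C`, double covering `X → C`,
`Y := X`, `Π_Y := Π_X`, the pro-`Σ` clause holding because `Δ_X = ℤ₂` is free pro-`{2}`-cyclic);
`Δ_X` is infinite; some curve of the model (`C`) is semi-elliptic as typed; and the schema
`Cor_3_3_ii` HOLDS at the model (`2ℤ₂` is the unique open subgroup of index `2` of the torsion-free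
`Π_C = Δ_C = ℤ₂`).  Non-vacuity certificate for `EllipticAdmissibilityWitness` /
`IsEllipticallyAdmissible` and instance form of FACT-LIST F-0234 (toy model, honest label in the
module docstring). [cite: MochizukiAbsTopII2013, Def 3.1 p.65] -/
theorem exists_twoAdic_isogenyModel :
    ∃ M : IsogenyModel.{0},
      (∃ X : M.Curve, M.IsOncePuncturedElliptic X ∧ IsEllipticallyAdmissible M X ∧
        Infinite ↥(M.ext X).geom) ∧
      (∃ C : M.Curve, M.IsSemiElliptic C) ∧ Cor_3_3_ii M := by
  classical
  -- the groups: `A = ℤ₂` (multiplicatively) and the trivial Galois group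
  let A : Type := Multiplicative ℤ_[2]
  let G₁ : Type := PUnit.{1}
  -- the extension `Π = ℤ₂ ↠ 1` (so `Δ = Π`)
  let E : FundamentalExtension.{0} :=
    ⟨ProfiniteGrp.of A, ProfiniteGrp.of G₁, 1, fun _ => ⟨1, Subsingleton.elim _ _⟩⟩
  have hgeom : ∀ x : E.arith, x ∈ E.geom := fun x => Subsingleton.elim _ _
  -- doubling on `ℤ₂`, multiplicatively: `x ↦ x * x`
  let sq : A →ₜ* A :=
    { toFun := fun x => x * x
      map_one' := mul_one 1
      map_mul' := fun a b => by
        change Multiplicative.ofAdd (a.toAdd + b.toAdd + (a.toAdd + b.toAdd)) =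
          Multiplicative.ofAdd (a.toAdd + a.toAdd + (b.toAdd + b.toAdd))
        congr 1
        ring
      continuous_toFun := continuous_id.mul continuous_id }
  -- `sq` is injective (`ℤ₂` has characteristic zero)
  have hsq_inj : Function.Injective sq := by
    intro a b h
    have h' : a.toAdd + a.toAdd = b.toAdd + b.toAdd := congrArg Multiplicative.toAdd h
    rw [← two_mul, ← two_mul] at h'
    exact Multiplicative.toAdd.injective (mul_left_cancel₀ two_ne_zero h')
  -- membership in the image: `x ∈ 2ℤ₂ ↔ x ≡ 0 mod 2`
  have hmem_range : ∀ x : A, x ∈ sq.toMonoidHom.range ↔ PadicInt.toZMod (p := 2) x.toAdd = 0 := by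
    intro x
    rw [← RingHom.mem_ker, PadicInt.ker_toZMod, PadicInt.maximalIdeal_eq_span_p,
      Ideal.mem_span_singleton']
    constructor
    · rintro ⟨y, rfl⟩
      exact ⟨y.toAdd, by change _ = y.toAdd + y.toAdd; push_cast; ring⟩
    · rintro ⟨a, ha⟩
      refine ⟨Multiplicative.ofAdd a, Multiplicative.toAdd.injective ?_⟩
      change a + a = x.toAdd
      rw [← ha]; push_cast; ring
  -- the image `2ℤ₂` is open
  have hsq_open : IsOpen (Set.range sq) := by
    have hball : Set.range sq =
        Multiplicative.toAdd ⁻¹' Metric.closedBall (0 : ℤ_[2]) ((2 : ℝ) ^ (-(1 : ℤ))) := by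
      ext x
      rw [Set.mem_preimage, Metric.mem_closedBall, dist_zero_right]
      have h1 := PadicInt.norm_le_pow_iff_mem_span_pow x.toAdd 1
      simp only [pow_one, Nat.cast_ofNat, Nat.cast_one] at h1
      rw [h1]
      change x ∈ sq.toMonoidHom.range ↔ _
      rw [hmem_range, ← RingHom.mem_ker, PadicInt.ker_toZMod, PadicInt.maximalIdeal_eq_span_p]
      simp only [Nat.cast_ofNat]
    rw [hball]
    exact (IsUltrametricDist.isOpen_closedBall _ (by norm_num)).preimage continuous_toAdd
  -- the image `2ℤ₂` has index `2`: it is the kernel of `ℤ₂ ↠ ℤ/2`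
  have hsq_index : sq.toMonoidHom.range.index = 2 := by
    let ψ : A →* Multiplicative (ZMod 2) := (PadicInt.toZMod (p := 2)).toAddMonoidHom.toMultiplicative
    have hker : ψ.ker = sq.toMonoidHom.range := by
      ext x
      rw [MonoidHom.mem_ker, hmem_range]
      exact Multiplicative.ofAdd.injective.eq_iff
    have hsurj : Function.Surjective ψ := fun y =>
      ⟨Multiplicative.ofAdd (ZMod.ringHom_surjective (PadicInt.toZMod (p := 2)) y.toAdd).choose,
        by
          apply Multiplicative.toAdd.injective
          exact (ZMod.ringHom_surjective (PadicInt.toZMod (p := 2)) y.toAdd).choose_spec⟩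
    rw [← hker, Subgroup.index_ker, MonoidHom.range_eq_top.mpr hsurj, Subgroup.card_top]
    simp [Nat.card_eq_fintype_card]
  -- the morphism of extensions induced by the double covering `D → C`
  let φ : E ⟶ E := ⟨sq, ContinuousMonoidHom.id _, fun _ => Subsingleton.elim _ _⟩
  have hφ : φ.IsOpenInjective :=
    { arith_injective := hsq_inj
      isOpen_range_arith := hsq_open
      gal_injective := fun _ _ _ => Subsingleton.elim _ _
      isOpen_range_gal := by
        rw [show Set.range φ.gal = Set.univ from Set.range_eq_univ.mpr fun x => ⟨x, rfl⟩]
        exact isOpen_univ }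
  have hφid : (𝟙 E : E ⟶ E).IsOpenInjective := Hom.IsOpenInjective.id E
  -- every map of the trivial Galois group is bijective
  have hbij : ∀ f : E.gal → E.gal, Function.Bijective f :=
    fun f => ⟨fun _ _ _ => Subsingleton.elim _ _, fun y => ⟨y, Subsingleton.elim _ _⟩⟩
  -- the model: `true = D` (once-punctured elliptic, a scheme), `false = C` (the stacky core);
  -- `k`-morphisms `D → D`, `C → C`, `D → C`
  let M : IsogenyModel.{0} :=
    { Curve := Bool
      ext := fun _ => E
      FinEt := fun Y X => PLift (Y = true ∨ X = false)
      extMap := fun {Y X} f =>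
        match Y, X, f with
        | true, true, _ => 𝟙 E
        | false, false, _ => 𝟙 E
        | true, false, _ => φ
        | false, true, ⟨h⟩ => absurd h (by simp)
      extMap_isOpenInjective := fun {Y X} f =>
        match Y, X, f with
        | true, true, _ => hφid
        | false, false, _ => hφid
        | true, false, _ => hφ
        | false, true, ⟨h⟩ => absurd h (by simp)
      IsScheme := fun b => b = true
      genus := fun _ => 1
      cuspCard := fun _ => 1
      IsDefinedOverNF := fun _ => True }
  -- the double covering `D → C`, and the identity of `D`
  let f : M.FinEt true false := ⟨Or.inl rfl⟩
  let i : M.FinEt true true := ⟨Or.inl rfl⟩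
  have hover : ∀ {Y X : M.Curve} (g : M.FinEt Y X), M.IsOver g := fun g => hbij _
  have hdeg : M.degree f = 2 := hsq_index
  -- `D` is a once-punctured elliptic curve, `C` is semi-elliptic, as typed
  have hD : M.IsOncePuncturedElliptic true := ⟨rfl, rfl, rfl⟩
  have hC : M.IsSemiElliptic false := ⟨Bool.false_ne_true, true, f, hover f, hD, hdeg⟩
  -- `C` is a `k`-core of `D`: every curve has exactly one `k`-morphism to `C`
  have hcore : M.IsCoreOf false true := by
    refine ⟨⟨f, hover f⟩, fun Y _ => ⟨⟨⟨Or.inr rfl⟩, hover _⟩, fun g g' _ _ => ?_⟩⟩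
    exact Subsingleton.elim _ _
  -- `Δ = ℤ₂` is free pro-`{2}`-cyclic and infinite
  let e : ↥E.geom ≃ₜ* A :=
    { toFun := fun x => x.1
      invFun := fun a => ⟨a, hgeom a⟩
      left_inv := fun _ => rfl
      right_inv := fun _ => rfl
      map_mul' := fun _ _ => rfl
      continuous_toFun := continuous_subtype_val
      continuous_invFun := continuous_id.subtype_mk _ }
  have hfree : IsFreeProSigmaCyclic {2} ↥E.geom :=
    IsFreeProSigmaCyclic.of_continuousMulEquiv e.symm (isFreeProSigmaCyclic_singleton_padicInt 2)
  have hinf : Infinite ↥E.geom :=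
    Infinite.of_injective e.symm e.symm.injective
  -- `Σ`-integers: positive, every prime factor in `Σ`
  have mkSig : ∀ {S : Set ℕ} {n : ℕ}, 0 < n → (∀ p : ℕ, p.Prime → p ∣ n → p ∈ S) →
      IsSigmaInteger S n := fun h0 h => And.intro h0 h
  have hsig2 : ∀ {S : Set ℕ}, 2 ∈ S → IsSigmaInteger S 2 := fun h2 =>
    mkSig two_pos fun p hp hdvd => by rwa [(Nat.prime_dvd_prime_iff_eq hp Nat.prime_two).1 hdvd]
  -- the key step of the pro-`Σ` clause: an open subgroup `H ⊆ Δ` that is pro-`Σ` forces `2 ∈ Σ`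
  have htwo : ∀ (S : Set ℕ) (H : Subgroup ↥E.geom), IsOpen (H : Set ↥E.geom) →
      IsProSigmaGroup S ↥H → 2 ∈ S := by
    intro S H hHo hHS
    -- `[Δ : H] = n` is a `{2}`-integer; take `K` open of index `2n`
    obtain ⟨hn0, hn⟩ := (hfree.isOpen_index_iff H.index).1 ⟨H, hHo, rfl⟩
    have h2n : IsSigmaInteger {2} (2 * H.index) := by
      refine mkSig (by positivity) fun p hp hdvd => ?_
      rcases (Nat.Prime.dvd_mul hp).1 hdvd with h | h
      · exact (Nat.prime_dvd_prime_iff_eq hp Nat.prime_two).1 h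
      · exact hn p hp h
    obtain ⟨K, hKo, hKi⟩ := (hfree.isOpen_index_iff (2 * H.index)).2 h2n
    -- `H` is not contained in `K`
    have hHK : ¬ H ≤ K := by
      intro hle
      have hdvd : 2 * H.index ∣ H.index := hKi ▸ Subgroup.index_dvd_of_le hle
      have := Nat.le_of_dvd hn0 hdvd
      omega
    -- `N := K ∩ H ⊆ H` is open, normal (`Δ` is abelian), of finite index `≠ 1`
    let N : Subgroup ↥H := K.subgroupOf H
    have hNo : IsOpen (N : Set ↥H) := hKo.preimage continuous_subtype_val
    have hNnormal : N.Normal := by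
      refine ⟨fun n hn g => ?_⟩
      have hcomm : g * n * g⁻¹ = n := by
        apply Subtype.ext
        apply Subtype.ext
        change (((g : ↥E.geom) : E.arith) : A) * (((n : ↥E.geom) : E.arith) : A) *
            ((((g : ↥E.geom) : E.arith) : A))⁻¹ = (((n : ↥E.geom) : E.arith) : A)
        exact mul_inv_cancel_comm _ _
      rw [hcomm]; exact hn
    have hKH_open : IsOpen ((K ⊓ H : Subgroup ↥E.geom) : Set ↥E.geom) := hKo.inter hHo
    obtain ⟨hKH0, hKH⟩ := (hfree.isOpen_index_iff (K ⊓ H).index).1 ⟨K ⊓ H, hKH_open, rfl⟩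
    have hprod : K.relIndex H * H.index = (K ⊓ H).index := by
      rw [← Subgroup.inf_relIndex_right]
      exact Subgroup.relIndex_mul_index inf_le_right
    have hNi : N.index = K.relIndex H := rfl
    have hN0 : N.index ≠ 0 := by
      rw [hNi]; intro h0; rw [h0, zero_mul] at hprod; exact hKH0.ne' hprod.symm |>.elim
    have hN1 : N.index ≠ 1 := by
      rw [hNi, Ne, Subgroup.relIndex_eq_one]; exact hHK
    haveI : N.FiniteIndex := ⟨hN0⟩
    -- so some prime divides `[H : N]`; it lies in `Σ` (as `H` is pro-`Σ`) and equals `2`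
    obtain ⟨p, hp, hpN⟩ := Nat.exists_prime_and_dvd hN1
    obtain ⟨-, hNS⟩ := (isProSigmaGroup_iff S ↥H).1 hHS N hNnormal hNo inferInstance
    have hpS : p ∈ S := hNS p hp hpN
    have hp2 : p = 2 := hKH p hp (hpN.trans ⟨H.index, by rw [hNi, hprod]⟩)
    exact hp2 ▸ hpS
  -- the witness of Def 3.1 for `X := D`, `Π := π₁(X)`
  let W : EllipticAdmissibilityWitness M true (ArithmeticQuotient.self (M.ext true)) :=
    { core := false
      toCore := f
      toCore_isOver := hover f
      isCoreOf := hcore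
      core_not_isScheme := Bool.false_ne_true
      ell := true
      ellToCore := f
      ellToCore_isOver := hover f
      ell_oncePunctured := hD
      degree_ellToCore := hdeg
      cov := true
      cov_isScheme := rfl
      covMap := i
      covToEll := i
      PiY := ⊤
      normal_PiY := inferInstance
      isOpen_PiY := by rw [Subgroup.coe_top]; exact isOpen_univ
      arithImage_covMap := by
        change (Hom.arith (𝟙 E)).toMonoidHom.range = (⊤ : Subgroup E.arith).comap (Hom.arith (𝟙 E)).toMonoidHom
        rw [Subgroup.comap_top]
        exact MonoidHom.range_eq_top.mpr fun x => ⟨x, rfl⟩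
      fac := rfl
      proSigma := by
        rintro S ⟨H, hHo, hHS⟩
        have h2 : 2 ∈ S := htwo S H hHo hHS
        refine ⟨(isProSigmaGroup_iff S _).2 fun N _ hNo _ => ?_, ?_⟩
        · obtain ⟨hN0, hN⟩ := (hfree.isOpen_index_iff N.index).1 ⟨N, hNo, rfl⟩
          exact mkSig hN0 fun p hp hdvd => (hN p hp hdvd : p = 2) ▸ h2
        · -- `deg(Y → C ×_k k_Y) = [Π_C : 2ℤ₂] = 2`
          have hcomp : M.extMap i ≫ M.extMap f = φ := Category.id_comp φ
          rw [hcomp]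
          have htop : ((φ.gal.toMonoidHom.range).comap (M.ext false).aug.toMonoidHom) = ⊤ := by
            refine top_unique fun x _ => ?_
            exact ⟨1, Subsingleton.elim _ _⟩
          rw [htop, Subgroup.relIndex_top_right]
          change IsSigmaInteger S sq.toMonoidHom.range.index
          rw [hsq_index]
          exact hsig2 h2 }
  refine ⟨M, ⟨true, hD, ⟨W⟩, hinf⟩, ⟨false, hC⟩, ?_⟩
  -- `Cor_3_3_ii` holds at the model
  intro C hCsemi
  -- a semi-elliptic curve of the model is not a scheme, hence is `C = false`
  cases C with
  | true => exact absurd rfl hCsemi.1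
  | false =>
    ext J
    constructor
    · -- a double covering by a once-punctured elliptic curve is `D → C`, with image `2ℤ₂`
      rintro ⟨D, g, -, ⟨hDs, -, -⟩, -, rfl⟩
      cases D with
      | false => exact absurd hDs Bool.false_ne_true
      | true =>
        change sq.toMonoidHom.range ∈ semiEllipticDoubleCoverSubgroups E
        refine ⟨hsq_open, hsq_index, ?_⟩
        infer_instance
    · -- an (open) index-`2` subgroup of `ℤ₂` contains all doubles, hence is `2ℤ₂`
      rintro ⟨-, hJ2, -⟩
      have hle : sq.toMonoidHom.range ≤ J := by
        rintro _ ⟨y, rfl⟩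
        have := Subgroup.pow_index_mem J y
        rw [hJ2, pow_two] at this
        exact this
      have hJeq : sq.toMonoidHom.range = J := by
        have h := Subgroup.relIndex_mul_index hle
        rw [hJ2, hsq_index] at h
        have h1 : (sq.toMonoidHom.range).relIndex J = 1 := by omega
        exact le_antisymm hle ((Subgroup.relIndex_eq_one).1 h1)
      exact ⟨true, f, hover f, hD, hdeg, hJeq.symm⟩

/-- **[AbsTopII] Def 3.1 as typed is satisfiable, non-vacuously in the pro-`Σ` clause**: there are
an isogeny-level model and a curve `X` of it which is a once-punctured elliptic curve as typed, is
elliptically admissible as typed (`IsEllipticallyAdmissible`, i.e. `Π = π₁(X)`), and has INFINITE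
geometric fundamental group `Δ_X` (`= ℤ₂`).  Toy model (2-adic skeleton); witnessed ≠ endorsed.
[cite: MochizukiAbsTopII2013, Def 3.1 p.65] -/
theorem exists_isEllipticallyAdmissible_model :
    ∃ (M : IsogenyModel.{0}) (X : M.Curve),
      M.IsOncePuncturedElliptic X ∧ IsEllipticallyAdmissible M X ∧ Infinite ↥(M.ext X).geom := by
  obtain ⟨M, ⟨X, hX, hadm, hinf⟩, -, -⟩ := exists_twoAdic_isogenyModel
  exact ⟨M, X, hX, hadm, hinf⟩

/-- **Census form** (INHABITATION-CENSUS-L4 row `AbsTopII.EllipticAdmissibilityWitness`): the data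
record of [AbsTopII] Def 3.1 (a)(b)(c) is inhabited at some model, curve and quotient (`Π = π₁(X)`).
[cite: MochizukiAbsTopII2013, Def 3.1 p.65] -/
theorem nonempty_ellipticAdmissibilityWitness :
    ∃ (M : IsogenyModel.{0}) (X : M.Curve) (Q : ArithmeticQuotient (M.ext X)),
      Nonempty (EllipticAdmissibilityWitness M X Q) := by
  obtain ⟨M, X, -, hadm, -⟩ := exists_isEllipticallyAdmissible_model
  exact ⟨M, X, _, hadm⟩

/-- **Instance form of FACT-LIST F-0234**: the typed schema `Cor_3_3_ii` ([AbsTopII] Cor 3.3 (ii)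
p. 68 over `IsogenyModel`), whose universal closure is refuted in
`AbsTopII/EllipticAdmissibleClosures.lean`, HOLDS at some model in which its hypothesis is met
(some curve is semi-elliptic as typed) — the 2-adic model: `2ℤ₂` is the unique subgroup of index `2`
of the torsion-free `Π_C = Δ_C = ℤ₂`.  So the row is a contingent schema, consumable by name.
Toy model; says nothing about the published theorem. [cite: MochizukiAbsTopII2013, Cor 3.3 (ii) p.68] -/
theorem exists_cor_3_3_ii_model :
    ∃ M : IsogenyModel.{0}, (∃ C : M.Curve, M.IsSemiElliptic C) ∧ Cor_3_3_ii M := by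
  obtain ⟨M, -, hC, h⟩ := exists_twoAdic_isogenyModel
  exact ⟨M, hC, h⟩

end Literature.AnabelianGeometry.AbsoluteAnabelian.AbsTopII

end
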